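import Literature.AlgebraicGeometry.Resolution.UnramifiedDefectlessExtensions
import Literature.AlgebraicGeometry.Resolution.SmoothUniformization
import Mathlib.FieldTheory.Normal.Closure
import Mathlib.FieldTheory.Normal.Basic
import HarnessLib

/-!
# Finite extensions of a defectless valued field with `e = 1` and separable residue field extension, II: the inertial generator

Topic: `Literature/AlgebraicGeometry/Resolution` (valued function fields). PROVED, continuing
`UnramifiedDefectlessExtensions.lean`: **a finite extension `K|F` of valued fields with
`(F, O ∩ F)` a defectless field, `|F^×| = |K^×|` and `κ(O)` separable over `κ(O ∩ F)` has a
generator `η ∈ O`, `K = F(η)`, whose minimal polynomial `f` over `F` has coefficients in `O ∩ F`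
and satisfies `|f'(η)| = 1`** (`exists_generator_valuation_derivative_eq_one`) — i.e. `O` is the
localisation of the standard-étale `(O ∩ F)`-algebra `((O ∩ F)[X]/(f))[1/f']` at the centre of
`O`. This is "`K/K_B` is unramified … and `K°` is étale over `K°_B`" in the proof of M. Temkin,
*Inseparable local uniformization*, J. Algebra 373 (2013) = arXiv:0804.1554v3, Thm. 5.5.1 (iii),
p. 59, for a stable `K_B` (used, with the generalized stability theorem, in
`AbhyankarToroidalChartsInertial.lean` to derive the named fact `Temkin2013_Thm551iii_inertial`).

The proof of `|f'(η)| = 1` (`valuation_aeval_derivative_minpoly_eq_one`), for `η` the generator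
of `UnramifiedDefectlessExtensions.lean`, is Galois-theoretic and avoids henselizations: in a
Galois closure `N` of the (separable) extension `K|F` with an extension `Õ` of `O`, the roots of
`f` are the conjugates `σ(η)`, all in `Õ`; a root of `Õ`-value `1` is `δ(η)` for `δ` in the
decomposition group `D` of `Õ` (if `σ(η)` is a unit then `σ⁻¹Õ ∩ K = O`, as `η` lies in the
maximal ideal of the other extensions, and the conjugation theorem over `K` corrects `σ` into
`D`), and `D ∩ Gal(N|K)` fixes `η`, so there are at most `[D : D ∩ Gal(N|K)] = e f = f(O/F)` such
roots (`ramificationIndex_mul_inertiaDegree_mul_card_inf`). Reducing modulo the maximal ideal of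
`Õ`, `f̄ = X^a ∏_{|ρ| = 1} (X - ρ̄)` over `κ(Õ ∩ F)`; the minimal polynomial `g` of `η̄`, separable
of degree `f(O/F) = [κ(O) : κ(O ∩ F)]` (the residue of `η` is a primitive element) and prime to `X`,
divides the second factor, of degree `≤ f(O/F)`, hence equals it: the residues of the roots of
value `1` are pairwise distinct (`nodup_of_card_le_natDegree_minpoly`), and `|η - ρ| = 1` for every
root `ρ ≠ η`, i.e. `|f'(η)| = |∏_{ρ ≠ η} (η - ρ)| = 1`.

## Sources

* M. Temkin, *Inseparable local uniformization*, J. Algebra 373 (2013) = arXiv:0804.1554v3,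
  proof of Thm. 5.5.1 (iii) (p. 59) and §2.1.
* F.-V. Kuhlmann, *Elimination of ramification I*, Trans. AMS 362 (2010), §2 (defect,
  henselization, inertially generated extensions) — the classical background.
* M. Raynaud, *Anneaux locaux henséliens*, LNM 169 (1970), Ch. X Thm. 1 (unramified local
  extensions of valuation rings are local-étale) — the statement proved here in elementary form.

## Rendering notes

As in part I. The residue-field side of the root count is isolated in the generic lemma
`nodup_of_card_le_natDegree_minpoly` (any field `κ`, subfield `κF`), instantiated at
`κ = ResidueField Õ`.
-/

noncomputable section

open scoped Pointwise IntermediateField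
open IsLocalRing Polynomial

namespace Literature.AlgebraicGeometry.Resolution

universe u

/-! ### Generic lemmas for the root count in the residue field -/

section Generic

/-- **Distinct residues from a degree bound.** Let `κF ⊆ κ` be fields, `θ ∈ κ` non-zero and
separable over `κF`, `f₀ ∈ κF[X]` with `f₀(θ) = 0` whose image in `κ[X]` is `X^a ∏_{b ∈ B} (X - b)`
for a multiset `B` with `#B ≤ deg minpoly_{κF}(θ)`. Then `B` has no repetition: the minimal
polynomial `g` of `θ` divides `f₀`, is prime to `X` (`θ ≠ 0`), so divides `∏_{b ∈ B} (X - b)`,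
which by the degree bound equals `g` and is therefore separable. [folklore] -/
theorem nodup_of_card_le_natDegree_minpoly {κ : Type u} [Field κ] (κF : Subfield κ) {θ : κ}
    (hsep : IsSeparable κF θ) (hθ0 : θ ≠ 0) (f₀ : Polynomial κF) (hf₀ : aeval θ f₀ = 0) (a : ℕ)
    (B : Multiset κ) (hfac : f₀.map (algebraMap κF κ) = X ^ a * (B.map fun b => X - C b).prod)
    (hcard : Multiset.card B ≤ (minpoly κF θ).natDegree) : B.Nodup := by
  classical
  have hint : IsIntegral κF θ := hsep.isIntegral
  set g := minpoly κF θ with hg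
  set gm := g.map (algebraMap κF κ) with hgm
  set P := (B.map fun b => X - C b).prod with hP
  have hgmon : gm.Monic := (minpoly.monic hint).map _
  have hPmon : P.Monic := monic_multiset_prod_of_monic _ _ fun b _ => monic_X_sub_C b
  -- `gm ∣ f₀ = X^a * P`
  have hdvd : gm ∣ X ^ a * P := by
    rw [← hfac]
    exact Polynomial.map_dvd _ (minpoly.dvd κF θ hf₀)
  -- `gm` is prime to `X`
  have hcop : IsCoprime (X ^ a) gm := by
    refine IsCoprime.pow_left ((Polynomial.irreducible_X).coprime_iff_not_dvd.mpr fun hX => ?_)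
    rw [X_dvd_iff, hgm, coeff_map] at hX
    exact minpoly.coeff_zero_ne_zero hint hθ0 ((_root_.map_eq_zero _).mp hX)
  have hdvdP : gm ∣ P := hcop.symm.dvd_of_dvd_mul_left hdvd
  -- degrees: `deg P = #B ≤ deg g = deg gm`, so `P = gm`
  have hdegP : P.natDegree = Multiset.card B := by
    rw [hP, natDegree_multiset_prod_of_monic]
    · simp
    · intro q hq
      obtain ⟨b, -, rfl⟩ := Multiset.mem_map.mp hq
      exact monic_X_sub_C b
  have hdeg : P.natDegree ≤ gm.natDegree := by
    rw [hdegP, hgm, natDegree_map_eq_of_injective (algebraMap κF κ).injective]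
    exact hcard
  have hPg : P = gm := eq_of_monic_of_dvd_of_natDegree_le hgmon hPmon hdvdP hdeg
  -- `gm` is separable, so `P` has distinct roots `B`
  have hPsep : P.Separable := by
    rw [hPg, hgm]
    exact Polynomial.Separable.map hsep
  have hroots : P.roots = B := by
    rw [hP, roots_multiset_prod_X_sub_C]
  rw [← hroots]
  exact nodup_roots hPsep

/-- Separability is transported along a field map onto the image subfield. [folklore] -/
theorem isSeparable_map_apply {κ₁ κ₂ : Type u} [Field κ₁] [Field κ₂] (φ : κ₁ →+* κ₂)
    (S : Subfield κ₁) {x : κ₁} (h : IsSeparable S x) : IsSeparable (S.map φ) (φ x) := by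
  let ψ : S →+* S.map φ := (φ.comp S.subtype).codRestrict (S.map φ)
    fun y => Subfield.mem_map.mpr ⟨y, y.2, rfl⟩
  have hcomp : (algebraMap (S.map φ) κ₂).comp ψ = φ.comp (algebraMap S κ₁) :=
    RingHom.ext fun y => rfl
  refine Polynomial.Separable.of_dvd (Polynomial.Separable.map (f := ψ) h) (minpoly.dvd _ _ ?_)
  rw [aeval_def, eval₂_map, hcomp, ← hom_eval₂, ← aeval_def, minpoly.aeval, map_zero]

/-- `[S : κF] ≤ [E : κF]` for subfields `κF ≤ S ≤ E` of `κ` (with `E` an intermediate field over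
`κF`). [folklore] -/
theorem finrank_subfield_le_of_le {κ : Type u} [Field κ] (κF : Subfield κ)
    (E : IntermediateField κF κ) [FiniteDimensional κF E] (S : Subfield κ) (hle : κF ≤ S)
    (hSE : S ≤ E.toSubfield) :
    letI : Algebra κF S := (Subfield.inclusion hle).toAlgebra
    Module.finrank κF S ≤ Module.finrank κF E := by
  letI : Algebra κF S := (Subfield.inclusion hle).toAlgebra
  let ι : S →ₗ[κF] E :=
    { toFun := fun x => ⟨x, hSE x.2⟩
      map_add' := fun _ _ => rfl
      map_smul' := fun _ _ => rfl }
  refine LinearMap.finrank_le_finrank_of_injective (f := ι) fun x y h => ?_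
  have h' := congrArg Subtype.val h
  exact Subtype.ext h'

/-- `[S : κF] = [E : κF]` for a subfield `S` equal to the intermediate field `E ⊇ κF`.
[folklore] -/
theorem finrank_subfield_eq_of_eq {κ : Type u} [Field κ] (κF : Subfield κ)
    (E : IntermediateField κF κ) (S : Subfield κ) (hle : κF ≤ S) (hSE : S = E.toSubfield) :
    letI : Algebra κF S := (Subfield.inclusion hle).toAlgebra
    Module.finrank κF S = Module.finrank κF E := by
  letI : Algebra κF S := (Subfield.inclusion hle).toAlgebra
  let ι : S ≃ₗ[κF] E :=
    { toFun := fun x => ⟨x, hSE.le x.2⟩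
      invFun := fun x => ⟨x, hSE.ge x.2⟩
      map_add' := fun _ _ => rfl
      map_smul' := fun _ _ => rfl
      left_inv := fun _ => rfl
      right_inv := fun _ => rfl }
  exact ι.finrank_eq

end Generic

/-! ### The derivative of the minimal polynomial of `η` is a unit -/

section Derivative

variable (F K : Type u) {N : Type u} [Field F] [Field K] [Field N] [Algebra F K] [Algebra F N]
  [Algebra K N] [IsScalarTower F K N] [FiniteDimensional F N] [IsGalois F N]
  [FiniteDimensional K N] [IsGalois K N] [FiniteDimensional F K]

/-- **The heart of the matter.** In the tower `F ⊆ K ⊆ N` with `N|F` finite Galois, let `Õ` be a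
valuation ring of `N`, `O = Õ ∩ K`, such that `F` is a defectless field at `Õ ∩ F`,
`|F^×| = |K^×|`, the residue field of `O` is separable over that of `O ∩ F`, and let `η ∈ O` be a
unit whose residue generates the residue field of `O`, which lies in the maximal ideal of every
other extension of `O ∩ F` to `K`. Then `|f'(η)| = 1` for `f = minpoly_F(η)` (whose
coefficients lie in `O ∩ F`): the roots of `f` in `N` are the `σ(η)`; those of value `1` lie in the orbit
of `η` under the decomposition group `D` of `Õ`, of size
`≤ [D : D ∩ Gal(N|K)] = e(O/F) f(O/F) = f(O/F)`; reducing `f = T^a ∏ (T - ρ̄)` modulo the maximal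
ideal of `Õ` and comparing with the (separable) minimal polynomial of `η̄`, of degree `f(O/F)`,
shows that the residues `ρ̄` of the roots of value `1` are pairwise distinct, so that
`|η - ρ| = 1` for every root `ρ ≠ η`. [folklore] -/
theorem valuation_aeval_derivative_minpoly_eq_one (Õ : ValuationSubring N)
    (hdef : IsDefectlessField F (Õ.comap (algebraMap F N)))
    (hE : valueSubgroup F (Õ.comap (algebraMap K N)) = ⊤)
    (hsep : ∀ r : ResidueField (Õ.comap (algebraMap K N)),
      IsSeparable (residueSubfield F (Õ.comap (algebraMap K N))) r)
    {η : K} (hη : η ∈ Õ.comap (algebraMap K N)) (hη1 : (Õ.comap (algebraMap K N)).valuation η = 1)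
    (hgen : IntermediateField.adjoin (residueSubfield F (Õ.comap (algebraMap K N)))
      {residue (Õ.comap (algebraMap K N)) ⟨η, hη⟩} = ⊤)
    (hother : ∀ W : ValuationSubring K,
      W.comap (algebraMap F K) = (Õ.comap (algebraMap K N)).comap (algebraMap F K) →
      W ≠ Õ.comap (algebraMap K N) → W.valuation η < 1) :
    Õ.valuation (algebraMap K N (aeval η (derivative (minpoly F η)))) = 1 := by
  classical
  set O := Õ.comap (algebraMap K N) with hOdef
  haveI : Algebra.IsSeparable F K := Algebra.isSeparable_tower_bot_of_isSeparable F K N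
  have hOF : O.comap (algebraMap F K) = Õ.comap (algebraMap F N) := by
    rw [hOdef, ValuationSubring.comap_comap, ← IsScalarTower.algebraMap_eq]
  -- notation
  set θ : N := algebraMap K N η with hθdef
  set f := minpoly F η with hfdef
  have hintη : IsIntegral F η := Algebra.IsIntegral.isIntegral η
  have hfθ : minpoly F θ = f := minpoly.algebraMap_eq (algebraMap K N).injective η
  set fN := f.map (algebraMap F N) with hfNdef
  have hmon : fN.Monic := (minpoly.monic hintη).map _
  have hfN0 : fN ≠ 0 := hmon.ne_zero
  have hsplit : fN.Splits := by
    rw [hfNdef, ← hfθ]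
    exact Normal.splits inferInstance θ
  have hsepf : fN.Separable := Polynomial.Separable.map (Algebra.IsSeparable.isSeparable F η)
  have hnodup : fN.roots.Nodup := nodup_roots hsepf
  have hθroot : θ ∈ fN.roots := by
    rw [hfNdef, mem_roots_map_of_injective (algebraMap F N).injective (minpoly.ne_zero hintη)]
    show aeval θ f = 0
    rw [← hfθ]
    exact minpoly.aeval F θ
  have hθ1 : Õ.valuation θ = 1 := (valuation_comap_eq_one_iff Õ η).mp hη1
  have hθÕ : θ ∈ Õ := hη
  -- `η` lies in every extension of `O ∩ F` to `K`
  have hηW : ∀ W : ValuationSubring K, W.comap (algebraMap F K) = O.comap (algebraMap F K) →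
      η ∈ W := by
    intro W hW
    by_cases hWO : W = O
    · rw [hWO]; exact hη
    · exact (W.valuation_le_one_iff η).mp (hother W hW hWO).le
  -- the Galois group, the decomposition group `D` of `Õ`, and `Gal(N|K)` inside `Gal(N|F)`
  set G := N ≃ₐ[F] N
  set D : Subgroup G := MulAction.stabilizer G Õ with hDdef
  set Hr : Subgroup G := (AlgEquiv.restrictScalarsHom F : (N ≃ₐ[K] N) →* G).range with hHrdef
  -- every root is a conjugate `σ θ`, lies in `Õ`, and has value `1` only on the `D`-orbit of `θ`
  have hroot_conj : ∀ ρ ∈ fN.roots, ∃ σ : G, σ θ = ρ := by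
    intro ρ hρ
    have hρ' : aeval ρ (minpoly F θ) = 0 := by
      rw [hfθ, aeval_def, ← eval_map, ← hfNdef]
      exact (mem_roots hfN0).mp hρ
    have hmin : minpoly F ρ = minpoly F θ :=
      (minpoly.eq_of_irreducible_of_monic (minpoly.irreducible (Algebra.IsIntegral.isIntegral θ))
        hρ' (minpoly.monic (Algebra.IsIntegral.isIntegral θ))).symm
    obtain ⟨σ, hσ⟩ := MulAction.mem_orbit_iff.mp
      ((Normal.minpoly_eq_iff_mem_orbit (F := F) (E := N)).mp hmin)
    exact ⟨σ, hσ⟩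
  have hconjW : ∀ σ : G, ((σ⁻¹ • Õ).comap (algebraMap K N)).comap (algebraMap F K) =
      O.comap (algebraMap F K) := by
    intro σ
    rw [ValuationSubring.comap_comap, ← IsScalarTower.algebraMap_eq, comap_smul_algEquiv, hOF]
  have hroot_mem : ∀ σ : G, σ θ ∈ Õ := by
    intro σ
    have h := hηW _ (hconjW σ)
    have h' : θ ∈ σ⁻¹ • Õ := h
    rw [ValuationSubring.mem_pointwise_smul_iff_inv_smul_mem, inv_inv] at h'
    exact h'
  have hroot_orbit : ∀ σ : G, Õ.valuation (σ θ) = 1 → σ θ ∈ MulAction.orbit D θ := by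
    intro σ hσ1
    set W := (σ⁻¹ • Õ).comap (algebraMap K N) with hWdef
    have hWO : W = O := by
      by_contra hne
      have hlt := hother W (hconjW σ) hne
      rw [hWdef, valuation_comap_lt_one_iff (σ⁻¹ • Õ) (algebraMap K N) η,
        valuation_smul_lt_one_iff, inv_inv, AlgEquiv.smul_def] at hlt
      exact hlt.ne hσ1
    obtain ⟨τ, hτ⟩ := exists_smul_eq_of_finiteDimensional K (σ⁻¹ • Õ) Õ hWO
    -- `δ = τ|_F σ⁻¹` stabilises `Õ`, and `δ⁻¹ θ = σ θ`
    have hδ : (AlgEquiv.restrictScalarsHom F τ * σ⁻¹ : G) ∈ D := by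
      show (AlgEquiv.restrictScalarsHom F τ * σ⁻¹ : G) • Õ = Õ
      rw [mul_smul, AlgEquiv.restrictScalarsHom_apply, restrictScalars_smul]
      exact hτ
    refine MulAction.mem_orbit_iff.mpr ⟨⟨_, D.inv_mem hδ⟩, ?_⟩
    rw [Subgroup.smul_def]
    show ((AlgEquiv.restrictScalarsHom F τ * σ⁻¹)⁻¹ : G) • θ = σ θ
    rw [mul_inv_rev, inv_inv, mul_smul, AlgEquiv.smul_def, AlgEquiv.smul_def]
    congr 1
    show (τ.restrictScalars F).symm (algebraMap K N η) = algebraMap K N η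
    exact τ.symm.commutes η
  -- the `D`-orbit of `θ` has at most `f(O/F)` elements
  have hstab_le : (D ⊓ Hr).subgroupOf D ≤ MulAction.stabilizer D θ := by
    intro d hd
    rw [Subgroup.mem_subgroupOf] at hd
    obtain ⟨-, τ, hτ⟩ := hd
    rw [MulAction.mem_stabilizer_iff, Subgroup.smul_def, ← hτ, AlgEquiv.restrictScalarsHom_apply,
      AlgEquiv.smul_def]
    exact τ.commutes η
  have hcardD := ramificationIndex_mul_inertiaDegree_mul_card_inf F K Õ hdef
  have he1 : ramificationIndex F O = 1 := by
    unfold ramificationIndex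
    rw [hE, Subgroup.index_top]
  have hsub : ((D ⊓ Hr).subgroupOf D).index = inertiaDegree F O := by
    have h1 := Subgroup.card_mul_index ((D ⊓ Hr).subgroupOf D)
    have h2 : Nat.card ↥((D ⊓ Hr).subgroupOf D) = Nat.card ↥(D ⊓ Hr) :=
      Nat.card_congr (Subgroup.subgroupOfEquivOfLe inf_le_left).toEquiv
    rw [h2] at h1
    rw [← hOdef, he1, one_mul, mul_comm] at hcardD
    have hpos : 0 < Nat.card ↥(D ⊓ Hr) := Nat.card_pos
    exact Nat.eq_of_mul_eq_mul_left hpos (h1.trans hcardD.symm)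
  have horbit : (MulAction.orbit D θ).ncard ≤ inertiaDegree F O := by
    rw [← MulAction.index_stabilizer, ← hsub]
    exact Nat.le_of_dvd (Nat.pos_of_ne_zero Subgroup.index_ne_zero_of_finite)
      (Subgroup.index_dvd_of_le hstab_le)
  have horbit_fin : (MulAction.orbit D θ).Finite := Set.finite_range _
  -- the roots lifted to `Õ`, the polynomial `fÕ` over `Õ` and its reduction
  have hrootsÕ : ∀ ρ ∈ fN.roots, ρ ∈ Õ := by
    intro ρ hρ
    obtain ⟨σ, rfl⟩ := hroot_conj ρ hρ
    exact hroot_mem σ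
  obtain ⟨rootsÕ, hrootsÕ_map⟩ : ∃ s : Multiset Õ, s.map Subtype.val = fN.roots := by
    refine ⟨fN.roots.attach.map fun ρ => ⟨ρ.1, hrootsÕ ρ.1 ρ.2⟩, ?_⟩
    rw [Multiset.map_map]
    have : (Subtype.val ∘ fun ρ : {x // x ∈ fN.roots} => (⟨ρ.1, hrootsÕ ρ.1 ρ.2⟩ : Õ)) =
        fun ρ => ρ.1 := rfl
    rw [this]
    exact Multiset.attach_map_val _
  have hmem_rootsÕ : ∀ r : Õ, r ∈ rootsÕ ↔ (r : N) ∈ fN.roots := by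
    intro r
    constructor
    · intro h
      rw [← hrootsÕ_map]
      exact Multiset.mem_map_of_mem _ h
    · intro h
      rw [← hrootsÕ_map, Multiset.mem_map] at h
      obtain ⟨r', hr', hr'r⟩ := h
      rwa [← Subtype.ext hr'r]
  have hrootsÕ_nodup : rootsÕ.Nodup :=
    Multiset.Nodup.of_map Subtype.val (by rw [hrootsÕ_map]; exact hnodup)
  set θÕ : Õ := ⟨θ, hθÕ⟩ with hθÕdef
  have hθÕmem : θÕ ∈ rootsÕ := (hmem_rootsÕ θÕ).mpr hθroot
  set θb := residue Õ θÕ with hθbdef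
  have hθb0 : θb ≠ 0 := by
    rw [hθbdef, Ne, residue_eq_zero_iff, ValuationSubring.valuation_lt_one_iff]
    exact fun h => h.ne hθ1
  -- the residue of `η` in `κ(Õ)` is `θb`; it is separable over `κ(Õ ∩ F)` and generates `κ(O)`
  set φ := residueFieldHom K Õ with hφdef
  have hφθ : φ (residue O ⟨η, hη⟩) = θb := by
    rw [hφdef, residueFieldHom_residue]
    exact congrArg (residue Õ) (Subtype.ext rfl)
  have hmapF : (residueSubfield F O).map φ = residueSubfield F Õ := map_residueSubfield F K Õ
  have hsepθ : IsSeparable (residueSubfield F Õ) θb := by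
    have h1 := isSeparable_map_apply φ (residueSubfield F O) (hsep (residue O ⟨η, hη⟩))
    rw [hφθ, hmapF] at h1
    exact h1
  have hintθ : IsIntegral (residueSubfield F Õ) θb := hsepθ.isIntegral
  have hle : residueSubfield F Õ ≤ residueSubfield K Õ := residueSubfield_le_residueSubfield F K Õ
  have hκK : residueSubfield K Õ =
      (IntermediateField.adjoin (residueSubfield F Õ) {θb}).toSubfield := by
    rw [← fieldRange_residueFieldHom K Õ, RingHom.fieldRange_eq_map]
    have htop' : (⊤ : Subfield (ResidueField O)) =
        (IntermediateField.adjoin (residueSubfield F O) {residue O ⟨η, hη⟩}).toSubfield := by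
      rw [hgen, IntermediateField.top_toSubfield]
    rw [← hφdef, htop', IntermediateField.adjoin_toSubfield, RingHom.map_field_closure,
      IntermediateField.adjoin_toSubfield, Set.image_union, Set.image_singleton, hφθ,
      range_algebraMap_subfield, range_algebraMap_subfield, ← Subfield.coe_map, hmapF]
  have hdeg : inertiaDegree F O = (minpoly (residueSubfield F Õ) θb).natDegree := by
    haveI : FiniteDimensional (residueSubfield F Õ)
        (IntermediateField.adjoin (residueSubfield F Õ) {θb}) :=
      IntermediateField.adjoin.finiteDimensional hintθ
    have hf₁ := finrank_eq_finrank_of_map_eq (residueFieldHom K Õ) (residueSubfield F O)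
      (map_residueSubfield F K Õ) (fieldRange_residueFieldHom K Õ) hle
    unfold inertiaDegree
    rw [hf₁, finrank_subfield_eq_of_eq (residueSubfield F Õ) _ (residueSubfield K Õ) hle hκK,
      IntermediateField.adjoin.finrank hintθ]
  -- the roots of value one and their residues
  set CaseB := rootsÕ.filter fun r : Õ => Õ.valuation (r : N) = 1 with hCaseBdef
  have hCaseB_card : Multiset.card CaseB ≤ inertiaDegree F O := by
    refine le_trans ?_ horbit
    have hnd : (CaseB.map Subtype.val).Nodup :=
      (hrootsÕ_nodup.filter _).map Subtype.val_injective
    have hsubset : ((CaseB.map Subtype.val).toFinset : Set N) ⊆ MulAction.orbit D θ := by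
      intro ρ hρ
      rw [Finset.mem_coe, Multiset.mem_toFinset, Multiset.mem_map] at hρ
      obtain ⟨r, hr, rfl⟩ := hρ
      obtain ⟨hr₁, hr₂⟩ := Multiset.mem_filter.mp hr
      obtain ⟨σ, hσ⟩ := hroot_conj _ ((hmem_rootsÕ r).mp hr₁)
      rw [← hσ] at hr₂ ⊢
      exact hroot_orbit σ hr₂
    calc Multiset.card CaseB = Multiset.card (CaseB.map Subtype.val) := (Multiset.card_map _ _).symm
      _ = (CaseB.map Subtype.val).toFinset.card := (Multiset.toFinset_card_of_nodup hnd).symm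
      _ = ((CaseB.map Subtype.val).toFinset : Set N).ncard := (Set.ncard_coe_finset _).symm
      _ ≤ (MulAction.orbit D θ).ncard := Set.ncard_le_ncard hsubset horbit_fin
  have hCaseB_nodup : (CaseB.map (residue Õ)).Nodup := by
    -- the polynomial `fÕ` over `Õ` lifting `fN`, and its reduction `ftil`
    set fÕ : Polynomial Õ := (rootsÕ.map fun r => X - C r).prod with hfÕdef
    have hfÕ_map : fÕ.map Õ.subtype = fN := by
      have h1 : fÕ.map Õ.subtype = ((rootsÕ.map Subtype.val).map fun ρ : N => X - C ρ).prod := by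
        rw [hfÕdef, Polynomial.map_multiset_prod, Multiset.map_map, Multiset.map_map]
        congr 1
        refine Multiset.map_congr rfl fun r _ => ?_
        simp only [Function.comp_apply, Polynomial.map_sub, Polynomial.map_X, Polynomial.map_C]
        rfl
      rw [h1, hrootsÕ_map, ← hsplit.eq_prod_roots_of_monic hmon]
    set M := rootsÕ.map (residue Õ) with hMdef
    set B := M.filter fun b => b ≠ 0 with hBdef
    have hBeq : B = CaseB.map (residue Õ) := by
      rw [hBdef, hMdef, Multiset.filter_map, hCaseBdef]
      congr 1
      refine Multiset.filter_congr fun r _ => ?_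
      rw [Function.comp_apply, Ne, residue_eq_zero_iff, ValuationSubring.valuation_lt_one_iff,
        not_lt]
      have hler : Õ.valuation (r : N) ≤ 1 := (Õ.valuation_le_one_iff _).mpr r.2
      exact ⟨fun h => le_antisymm hler h, fun h => h.ge⟩
    set ftil := fÕ.map (residue Õ) with hftildef
    have hftil : ftil = X ^ (Multiset.card (M.filter fun b => b = 0)) *
        (B.map fun b => X - C b).prod := by
      have h1 : ftil = (M.map fun b => X - C b).prod := by
        rw [hftildef, hfÕdef, Polynomial.map_multiset_prod, Multiset.map_map, hMdef,
          Multiset.map_map]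
        congr 1
        refine Multiset.map_congr rfl fun r _ => ?_
        simp only [Function.comp_apply, Polynomial.map_sub, Polynomial.map_X, Polynomial.map_C]
      rw [h1]
      conv_lhs => rw [← Multiset.filter_add_not (fun b => b = 0) M]
      rw [Multiset.map_add, Multiset.prod_add]
      congr 1
      have h0 : ((M.filter fun b => b = 0).map fun b => (X - C b : Polynomial (ResidueField Õ))) =
          (M.filter fun b => b = 0).map fun _ => X := by
        refine Multiset.map_congr rfl fun b hb => ?_
        rw [(Multiset.mem_filter.mp hb).2, map_zero, sub_zero]
      rw [h0, Multiset.map_const', Multiset.prod_replicate]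
    -- `ftil` has coefficients in `κ(Õ ∩ F)`: it is the reduction of `f ∈ (O ∩ F)[X]`
    have hcoefÕ : ∀ i, (fÕ.coeff i : N) = algebraMap F N (f.coeff i) := by
      intro i
      have h := congrArg (fun p : Polynomial N => p.coeff i) hfÕ_map
      simp only [Polynomial.coeff_map] at h
      rw [hfNdef, Polynomial.coeff_map] at h
      exact h
    have hlift : ftil ∈ Polynomial.lifts (algebraMap (residueSubfield F Õ) (ResidueField Õ)) := by
      rw [Polynomial.lifts_iff_coeff_lifts]
      intro i
      rw [hftildef, Polynomial.coeff_map]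
      have hmemÕ : algebraMap F N (f.coeff i) ∈ Õ := by rw [← hcoefÕ]; exact (fÕ.coeff i).2
      have heq : fÕ.coeff i = ⟨algebraMap F N (f.coeff i), hmemÕ⟩ := Subtype.ext (hcoefÕ i)
      rw [heq]
      exact ⟨⟨_, residue_mem_residueSubfield F Õ (f.coeff i) hmemÕ⟩, rfl⟩
    obtain ⟨f₀, hf₀⟩ := (Polynomial.mem_lifts _).mp hlift
    -- `fÕ(θ) = 0`, so `f₀(θb) = 0`
    have hfÕθ : fÕ.eval θÕ = 0 := by
      apply Subtype.val_injective
      show Õ.subtype (fÕ.eval θÕ) = ((0 : Õ) : N)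
      rw [← eval₂_at_apply, ← eval_map, hfÕ_map]
      exact (mem_roots hfN0).mp hθroot
    have hf₀θ : aeval θb f₀ = 0 := by
      rw [aeval_def, ← eval_map, hf₀, hftildef, hθbdef, eval_map, eval₂_at_apply, hfÕθ, map_zero]
    -- the degree bound and the conclusion
    have hcard : Multiset.card B ≤ (minpoly (residueSubfield F Õ) θb).natDegree := by
      rw [hBeq, Multiset.card_map, ← hdeg]
      exact hCaseB_card
    have hB := nodup_of_card_le_natDegree_minpoly (residueSubfield F Õ) hsepθ hθb0 f₀ hf₀θ _ B
      (hf₀.trans hftil) hcard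
    rwa [hBeq] at hB
  -- conclusion: `|θ - ρ| = 1` for every root `ρ ≠ θ`
  have hkey : ∀ ρ ∈ fN.roots, ρ ≠ θ → Õ.valuation (θ - ρ) = 1 := by
    intro ρ hρ hne
    have hρÕ : ρ ∈ Õ := hrootsÕ ρ hρ
    by_cases hlt : Õ.valuation ρ < 1
    · rw [Valuation.map_sub_eq_of_lt_left _ (by rw [hθ1]; exact hlt), hθ1]
    · have hρ1 : Õ.valuation ρ = 1 :=
        le_antisymm ((Õ.valuation_le_one_iff ρ).mpr hρÕ) (not_lt.mp hlt)
      set ρÕ : Õ := ⟨ρ, hρÕ⟩ with hρÕdef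
      have hρmem : ρÕ ∈ CaseB := Multiset.mem_filter.mpr ⟨(hmem_rootsÕ ρÕ).mpr hρ, hρ1⟩
      have hθmem : θÕ ∈ CaseB := Multiset.mem_filter.mpr ⟨hθÕmem, hθ1⟩
      have hres : residue Õ θÕ ≠ residue Õ ρÕ := fun h =>
        hne (congrArg Subtype.val
          (Multiset.inj_on_of_nodup_map hCaseB_nodup θÕ hθmem ρÕ hρmem h)).symm
      have hunit : IsUnit (θÕ - ρÕ) := by
        rw [← residue_ne_zero_iff_isUnit, map_sub, sub_ne_zero]
        exact hres
      exact (Õ.valuation_eq_one_iff _).mp hunit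
  -- the derivative is the product of the `θ - ρ`
  have hderiv : algebraMap K N (aeval η (derivative f)) = fN.derivative.eval θ := by
    rw [hfNdef, derivative_map, eval_map, ← aeval_def, aeval_algebraMap_apply]
  rw [hderiv, hsplit.eval_root_derivative hmon hθroot, map_multiset_prod, Multiset.map_map]
  refine Multiset.prod_eq_one fun v hv => ?_
  obtain ⟨ρ, hρ, rfl⟩ := Multiset.mem_map.mp hv
  obtain ⟨hρθ, hρroot⟩ := (hnodup.mem_erase_iff).mp hρ
  exact hkey ρ hρroot hρθ

end Derivative

/-! ### The theorem -/

section Main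

variable {F K : Type u} [Field F] [Field K] [Algebra F K] [FiniteDimensional F K]

/-- **Unramified defectless extensions are local-standard-étale** (the valuation theory behind
"the extension `K/K_B` is unramified because `K_B` is stable, `|K_B^×| = |K^×|` and `K̃` is
separable over `K̃_B` … and `K°` is étale over `K°_B`", M. Temkin, *Inseparable local
uniformization*, J. Algebra 373 (2013), proof of Thm. 5.5.1 (iii), p. 59 of arXiv:0804.1554v3;
classical: for a defectless (= stable) base the extension is defectless, `e = 1` and the
separability of the residue field extension make the henselisation unramified, and an
unramified local extension of valuation rings is a localisation of a standard-étale algebra,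
cf. F.-V. Kuhlmann, Trans. AMS 362 (2010), §2, and M. Raynaud, *Anneaux locaux henséliens*,
LNM 169, Ch. X Thm. 1). Let `K|F` be a finite extension, `O` a valuation ring of `K` such that
`(F, O ∩ F)` is a defectless field, `|F^×| = |K^×|` and the residue field of `O` is separable
over that of `O ∩ F`. Then there is `η ∈ O` with `K = F(η)` whose minimal polynomial `f` over
`F` has coefficients in `O ∩ F` and satisfies `|f'(η)| = 1`. PROVED here without henselisations:
`K|F` is separable (`isSeparable_of_isDefectlessField`); `η` is produced by the Chinese
remainder theorem in the integral closure of `O ∩ F` (`exists_unit_generator_mem_maximalIdeal`),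
generates `K` by defectlessness of `F(η)` (`adjoin_simple_eq_top_of_isDefectlessField`), and
`|f'(η)| = 1` is read off in a Galois closure from the count `e f = |D|` of the decomposition
group of a defectless Galois extension (`valuation_aeval_derivative_minpoly_eq_one`).
[cite: Temkin2013, proof of Thm. 5.5.1 (iii) (p. 59 of arXiv:0804.1554v3)] -/
theorem exists_generator_valuation_derivative_eq_one (O : ValuationSubring K)
    (hdef : IsDefectlessField F (O.comap (algebraMap F K))) (hE : valueSubgroup F O = ⊤)
    (hsep : ∀ r : ResidueField O, IsSeparable (residueSubfield F O) r) :
    ∃ η : K, η ∈ O ∧ F⟮η⟯ = ⊤ ∧ (∀ i, (minpoly F η).coeff i ∈ O.comap (algebraMap F K)) ∧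
      O.valuation (aeval η (derivative (minpoly F η))) = 1 := by
  haveI : Algebra.IsSeparable F K := isSeparable_of_isDefectlessField O hdef hE hsep
  obtain ⟨η, hη, hη1, hgen, hcoef, hother⟩ := exists_unit_generator_mem_maximalIdeal O hdef hsep
  have htop := adjoin_simple_eq_top_of_isDefectlessField O hdef hE hη hη1 hgen hother
  refine ⟨η, hη, htop, hcoef, ?_⟩
  -- a Galois closure `N` of `K|F`
  let L := AlgebraicClosure K
  let N : IntermediateField F L := IntermediateField.normalClosure F K L
  haveI : Algebra.IsSeparable F N := by
    have h : ∀ g : K →ₐ[F] L, Algebra.IsSeparable F g.fieldRange := fun g =>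
      AlgEquiv.Algebra.isSeparable (AlgEquiv.ofInjectiveField g)
    show Algebra.IsSeparable F (IntermediateField.normalClosure F K L)
    rw [normalClosure_def]
    infer_instance
  haveI : IsGalois F N := isGalois_iff.mpr ⟨inferInstance, inferInstance⟩
  haveI : FiniteDimensional K N := Module.Finite.of_restrictScalars_finite F K N
  haveI : IsGalois K N := IsGalois.tower_top_of_isGalois F K N
  -- extend `O` to `N`
  obtain ⟨Õ, hÕ⟩ := exists_valuationSubring_comap_eq (Ω := N) O
  subst hÕ
  have hdef' : IsDefectlessField F (Õ.comap (algebraMap F N)) := by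
    rwa [ValuationSubring.comap_comap, ← IsScalarTower.algebraMap_eq] at hdef
  exact (valuation_comap_eq_one_iff Õ _).mpr
    (valuation_aeval_derivative_minpoly_eq_one F K Õ hdef' hE hsep hη hη1 hgen hother)

end Main

end Literature.AlgebraicGeometry.Resolution

end
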